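import Literature.AlgebraicGeometry.Motives.AbelianVarietyCotangentHom
import Literature.AlgebraicGeometry.Motives.AbelianVarietyLie
import Literature.AlgebraicGeometry.GroupSchemes.GroupSchemeKernel
import Literature.AlgebraicGeometry.GroupSchemes.AffineGroupSchemeOfHopfAlgebra            -- ★ `Alg.comap`
import Literature.AlgebraicGeometry.GroupSchemes.BarsottiTateGroupFixedPartCotangent       -- ★ p846312 (B-p08): `ker_unit_le_comap`
import Literature.AlgebraicGeometry.GroupSchemes.UnitAugmentationIdealStalk                -- `unitAugIdeal`, `isLocalization_stalk_unitAugIdeal`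
import Literature.RingTheory.Localization.CotangentAtMaximalIdeal                          -- ★ `cotangentLocalizationEquiv`
import HarnessLib

/-!
# The cotangent space of a kernel: `φ^* = 0` on `𝔪_e ∕ 𝔪_e²` ⇒ `I_e(Ker φ) ∕ I_e(Ker φ)² ≅ 𝔪_{A,e} ∕ 𝔪_{A,e}²`, naturally

Topic `Literature/AlgebraicGeometry/Motives`; namespace `Literature.AlgebraicGeometry.Motives.AbelianVariety`.  THEOREMS, with PRIVATE plumbing only
(`Hom.kerG ∕ kerGι ∕ kerGOrigin ∕ kerGUnitIdeal` = ★ `GroupSchemeKernel.ker ∕ kerι` of the underlying homomorphism, its unit point and augmentation ideal;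
`Hom.kerGStalkMap ∕ kerGEndStalkMap` = the transported stalk maps `ι^*`, `v^*` in the style of ★ `Hom.stalkMapOrigin`); no named fact, no instance, no notation,
no `sorry`.  Cell `hodgecm-mathlib` (D-0151), P6 «MOD programme», K∕BT cut v2 «BLOCK-AT-A-POINT» DEAL 2 (F0P6d-plan (g2) → B-p12 (g32)) «THE COTANGENT SPACE OF A
KERNEL»: the ENGINE over ★ `GroupSchemes/UnitAugmentationIdealStalk`; the torsion `A[N]` ∕ `A[pⁿ]` head is the sequel `Motives/AbelianVarietyTorsionCotangent`.
HC_CM is proved only modulo the printed citations until rung 0 closes; nothing here is about HC.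

THE PRINT.  [GortzWedhorn2020] Definition 4.45 (2) (p. 117): the kernel `Ker f = G ×_{H,e} S` of a homomorphism of group schemes; (6.4) Definition 6.2: the
cotangent space `𝔪_x ∕ 𝔪_x²`, Remark 6.3 (3): its functoriality `f_x^♯`, and points with values in a local ring (`Spec R → X` ↔ local homomorphisms
`𝒪_{X,x} → R`); §6.3 (6.3.1)–Remark 6.4: `𝔪_x ∕ 𝔪_x² = 𝔪 ∕ 𝔪²` on an affine chart.  PROVED HERE: for a homomorphism `φ : A → B` of abelian varieties over a
field `k` whose cotangent map `φ^* : 𝔪_{B,e} ∕ 𝔪² → 𝔪_{A,e} ∕ 𝔪²` VANISHES (e.g. `φ = [N]`, `N = 0` in `k`, since `[N]^* = N`) and whose kernel is affine,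
the closed immersion `ι : Ker φ ↪ A` induces an ISOMORPHISM `ι^* : 𝔪_{A,e} ∕ 𝔪_{A,e}² ⥲ 𝔪_{Ker φ,e} ∕ 𝔪_{Ker φ,e}²` (dually `T_e(Ker φ) = Ker(T_e φ) = T_e A`),
read in the GLOBAL currency `I_e ∕ I_e²`, `I_e = ker Γ(η_{Ker φ}) ⊆ Γ(Ker φ)` of ★ `BarsottiTateGroupConnectedPartTangent` ∕ the P6b kit's `htan`, `hdim`.
PROOF (no ideal sheaves, no duality): `ι^*` is surjective (closed immersion); its kernel lies in `𝔪_{A,e}²` because the canonical point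
`t₂ : Spec(𝒪_{A,e} ∕ 𝔪²) → A` has `t₂ ≫ φ = e` (`φ^* ≡ ev mod 𝔪²`), hence factors through `Ker φ` (universal property ★ `kerLift`), and the local homomorphism
of the factorisation is a retraction `𝒪_{Ker φ,e} → 𝒪_{A,e} ∕ 𝔪²` of `ι^*`; finally `I_e ∕ I_e² ≅ 𝔪_{Ker φ,e} ∕ 𝔪²` by ★ `cotangentLocalizationEquiv` (★
`isLocalization_stalk_unitAugIdeal`, `unitAugIdeal_isMaximal`).  PUBLIC STATEMENTS: `ptOfStalkHom_comp_toSchemeHom'`, `ptOfStalkHom_evalOrigin`, and the HEAD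
**`Hom.exists_cotangentEquiv_ker`** (`∃ Φ : I_e(Ker f) ∕ I_e² ≃ₗ[k] Cotangent A`, with `Φ ∘ Γ(v)^* = u^* ∘ Φ` for every pair `v ≫ ι = ι ≫ u`; the kernel is formed on a
syntactically arbitrary homomorphism `f = φ` so that `f := [N]` is the torsion of ★ `AbelianSchemeOver.torsion` on the nose).

## References
* [GortzWedhorn2020] U. Görtz, T. Wedhorn, *Algebraic Geometry I* (2nd ed., 2020) — Definition 4.45 (p. 117); (6.4) Definition 6.2, Remark 6.3 (3); §6.3 (6.3.1), Remark 6.4.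
-/

set_option autoImplicit false

noncomputable section

universe u

open CategoryTheory CategoryTheory.Limits AlgebraicGeometry MonoidalCategory CartesianMonoidalCategory
open IsLocalRing
open scoped MonObj

namespace Literature.AlgebraicGeometry.Motives

namespace AbelianVariety

open Literature.AlgebraicGeometry.GroupSchemes Literature.AlgebraicGeometry.GroupSchemes.GroupSchemeKernel
open Literature.AlgebraicGeometry.GroupSchemes.AffineGroupScheme

variable {k : Type u} [Field k] {A B : AbelianVariety k} (φ : A ⟶ B)

/-! ## §0 The group-scheme kernel `Ker f` of a homomorphism of abelian varieties and its unit point -/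

/-- The kernel `Ker φ ⊆ A` of a homomorphism of abelian varieties as a `k`-GROUP SCHEME: ★ `GroupSchemeKernel.ker` of the
underlying homomorphism `φ : A → B` of `k`-group schemes (the fibre product `A ×_{B,e} Spec k` in `Over (Spec k)`; for `φ = [N]`
this is literally the torsion `A[N]` of ★ `AbelianSchemeOver.torsion`). [cite: GortzWedhorn2020, Definition 4.45 (2), p. 117] -/
private abbrev Hom.kerG : SchemeOver k := GroupSchemeKernel.ker φ.hom.hom.hom

/-- The inclusion `ι : Ker φ ⟶ A` (★ `GroupSchemeKernel.kerι`), a homomorphism and a closed immersion.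
[cite: GortzWedhorn2020, Definition 4.45 (2), p. 117] -/
private abbrev Hom.kerGι : Hom.kerG φ ⟶ A.X := GroupSchemeKernel.kerι φ.hom.hom.hom

/-- The unit point `e ∈ Ker φ`: the image of the closed point of `Spec k` under the unit section of the group scheme `Ker φ`.
[cite: GortzWedhorn2020, Definition 4.45 (2), p. 117] -/
private abbrev Hom.kerGOrigin : ↥(Hom.kerG φ).left :=
  ((η[Hom.kerG φ] : 𝟙_ (SchemeOver k) ⟶ Hom.kerG φ).left).base (specPt k)

/-- The augmentation ideal `I_e = ker Γ(η)` of the unit of `Ker φ` (explicit `htan` currency). [cite: GortzWedhorn2020, (6.4) Definition 6.2] -/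
private abbrev Hom.kerGUnitIdeal : Ideal (Alg (Hom.kerG φ)) :=
  RingHom.ker ((η[Hom.kerG φ] : 𝟙_ (SchemeOver k) ⟶ Hom.kerG φ).left.appTop.hom)

/-- The stalk `𝒪_{Ker φ, e}` at the unit point. [cite: GortzWedhorn2020, (6.4) Definition 6.2] -/
private abbrev Hom.kerGStalk : CommRingCat.{u} := (Hom.kerG φ).left.presheaf.stalk (Hom.kerGOrigin φ)

/-- `Ker φ ⟶ A` is a closed immersion (the unit section of the separated `B → Spec k` is a closed immersion; ★
`isClosedImmersion_kerι_left_of_isSeparated`). [cite: GortzWedhorn2020, Definition 4.45 (2), p. 117] -/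
private theorem Hom.isClosedImmersion_kerGι_left : IsClosedImmersion (Hom.kerGι φ).left :=
  isClosedImmersion_kerι_left_of_isSeparated (H := B.X) φ.hom.hom.hom

/-- `η_{Ker φ} ≫ ι = η_A` on underlying schemes. [cite: GortzWedhorn2020, Definition 4.45 (2), p. 117] -/
private theorem Hom.one_left_comp_kerGι_left :
    (η[Hom.kerG φ] : 𝟙_ (SchemeOver k) ⟶ _).left ≫ (Hom.kerGι φ).left = unitPt A := by
  rw [← Over.comp_left, one_comp_kerι]

/-- The unit point of `Ker φ` maps to the origin of `A`. [cite: GortzWedhorn2020, Definition 4.45 (2), p. 117] -/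
private theorem Hom.kerGι_kerGOrigin : (Hom.kerGι φ).left.base (Hom.kerGOrigin φ) = origin A := by
  change ((η[Hom.kerG φ] : 𝟙_ (SchemeOver k) ⟶ _).left ≫ (Hom.kerGι φ).left).base (specPt k) = _
  rw [Hom.one_left_comp_kerGι_left]
  rfl

/-- `ι ≫ (A → Spec k) = (Ker φ → Spec k)`. [cite: GortzWedhorn2020, Definition 4.45 (2), p. 117] -/
private theorem Hom.kerGι_left_comp_hom : (Hom.kerGι φ).left ≫ A.X.hom = (Hom.kerG φ).hom := Over.w _

/-! ## §1 The stalk map `ι^* : 𝒪_{A,e} → 𝒪_{Ker φ,e}` of the closed immersion: a surjective local `k`-algebra map -/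

/-- The local homomorphism `ι^* : 𝒪_{A,e} → 𝒪_{Ker φ, e}` of the closed immersion `ι : Ker φ ⟶ A` at the unit point, transported
along `ι(e) = e` (Görtz–Wedhorn I, Remark 6.3 (3): the local homomorphism `f_x^♯`). [cite: GortzWedhorn2020, Remark 6.3 (3)] -/
private def Hom.kerGStalkMap : stalkOrigin A ⟶ (Hom.kerG φ).left.presheaf.stalk (Hom.kerGOrigin φ) :=
  (A.X.left.presheaf.stalkCongr (.of_eq (Hom.kerGι_kerGOrigin φ))).inv ≫
    (Hom.kerGι φ).left.stalkMap (Hom.kerGOrigin φ)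

/-- The unit point lies in `ι⁻¹ U` for every open `U ∋ e` of `A`. [cite: GortzWedhorn2020, Remark 6.3 (3)] -/
private theorem Hom.kerGOrigin_mem_preimage {U : A.X.left.Opens} (hU : origin A ∈ U) :
    Hom.kerGOrigin φ ∈ (Hom.kerGι φ).left ⁻¹ᵁ U := by
  change (Hom.kerGι φ).left.base _ ∈ U
  rw [Hom.kerGι_kerGOrigin]
  exact hU

/-- `ι^*` on germs: `ι^*(s_e) = (ι^♯ s)_e`. [cite: GortzWedhorn2020, Remark 6.3 (3)] -/
@[reassoc]
private theorem Hom.germ_kerGStalkMap (U : A.X.left.Opens) (hU : origin A ∈ U) :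
    A.X.left.presheaf.germ U (origin A) hU ≫ Hom.kerGStalkMap φ =
      (Hom.kerGι φ).left.app U ≫
        (Hom.kerG φ).left.presheaf.germ ((Hom.kerGι φ).left ⁻¹ᵁ U) (Hom.kerGOrigin φ) (Hom.kerGOrigin_mem_preimage φ hU) := by
  rw [Hom.kerGStalkMap, TopCat.Presheaf.stalkCongr_inv, TopCat.Presheaf.germ_stalkSpecializes_assoc,
    Scheme.Hom.germ_stalkMap]

/-- `ι^*` on germs, applied form. [cite: GortzWedhorn2020, Remark 6.3 (3)] -/
private theorem Hom.kerGStalkMap_germ (U : A.X.left.Opens) (hU : origin A ∈ U) (s : Γ(A.X.left, U)) :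
    Hom.kerGStalkMap φ (A.X.left.presheaf.germ U (origin A) hU s) =
      (Hom.kerG φ).left.presheaf.germ ((Hom.kerGι φ).left ⁻¹ᵁ U) (Hom.kerGOrigin φ) (Hom.kerGOrigin_mem_preimage φ hU)
        ((Hom.kerGι φ).left.app U s) := by
  rw [← CommRingCat.comp_apply, Hom.germ_kerGStalkMap]
  rfl

/-- `ι^*` is a local homomorphism. [cite: GortzWedhorn2020, Remark 6.3 (3)] -/
private theorem Hom.isLocalHom_kerGStalkMap : IsLocalHom (Hom.kerGStalkMap φ).hom := by
  unfold Hom.kerGStalkMap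
  rw [CommRingCat.hom_comp]
  infer_instance

/-- `ι^*` is surjective (stalk maps of closed immersions are surjective). [cite: GortzWedhorn2020, Remark 6.3 (3)] -/
private theorem Hom.kerGStalkMap_surjective : Function.Surjective (Hom.kerGStalkMap φ) := by
  haveI := Hom.isClosedImmersion_kerGι_left φ
  intro y
  obtain ⟨x, hx⟩ := (Hom.kerGι φ).left.stalkMap_surjective (Hom.kerGOrigin φ) y
  refine ⟨(A.X.left.presheaf.stalkCongr (.of_eq (Hom.kerGι_kerGOrigin φ))).hom x, ?_⟩
  rw [Hom.kerGStalkMap, CommRingCat.comp_apply, Iso.hom_inv_id_apply, hx]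

/-- `ι^*` is a `k`-algebra map: it sends the constant `c ∈ 𝒪_{A,e}` to the germ of the constant function `c ∈ Γ(Ker φ)`.
[cite: GortzWedhorn2020, Remark 6.3 (3)] -/
private theorem Hom.kerGStalkMap_algebraMap (c : k) :
    Hom.kerGStalkMap φ (stalkOriginAlgebraMap A c) =
      (Hom.kerG φ).left.presheaf.germ ⊤ (Hom.kerGOrigin φ) _root_.trivial (algebraMap k (Alg (Hom.kerG φ)) c) := by
  rw [stalkOriginAlgebraMap_apply, Hom.kerGStalkMap_germ]
  have h1 : (Hom.kerGι φ).left.app ⊤ (A.X.hom.appTop ((Scheme.ΓSpecIso (.of k)).inv c)) =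
      (Hom.kerG φ).hom.appTop ((Scheme.ΓSpecIso (.of k)).inv c) := by
    rw [← Hom.kerGι_left_comp_hom, Scheme.Hom.comp_appTop, CommRingCat.comp_apply]
    rfl
  rw [h1]
  rfl


/-! ## §2 The kernel of `ι^*` lies in `𝔪_e²` when `φ^* = 0` on `𝔪_e/𝔪_e²` (a retraction through the `𝒪_{A,e}/𝔪_e²`-valued point) -/

/-- Functoriality of local-ring-valued points in the homomorphism: `Spec R → A —φ→ B` is the point of `φ^* ≫ g`
(Görtz–Wedhorn I, Remark 6.3 (3)). [cite: GortzWedhorn2020, Remark 6.3 (3)] -/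
theorem Hom.ptOfStalkHom_comp_toSchemeHom' {R : CommRingCat.{u}} (g : stalkOrigin A ⟶ R) :
    ptOfStalkHom g ≫ Hom.toSchemeHom φ = ptOfStalkHom (Hom.stalkMapOrigin φ ≫ g) := by
  rw [ptOfStalkHom, ptOfStalkHom, Hom.stalkMapOrigin, Category.assoc,
    ← Scheme.SpecMap_stalkMap_fromSpecStalk, TopCat.Presheaf.stalkCongr_inv,
    ← Scheme.SpecMap_stalkSpecializes_fromSpecStalk (specializes_of_eq (toSchemeHom_origin φ)),
    Spec.map_comp, Spec.map_comp, Category.assoc, Category.assoc]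

/-- Moving the base point: for a point `y = e` of `Ker φ`, the stalk map of `ι` at `y` (transported to `𝒪_{A,e}`) is `ι^*` followed
by the identification of stalks `𝒪_{Ker φ,e} ≅ 𝒪_{Ker φ,y}`. [cite: GortzWedhorn2020, Remark 6.3 (3)] -/
private theorem Hom.kerGStalkMap_comp_stalkCongr_inv {y : ↥(Hom.kerG φ).left} (hy : y = Hom.kerGOrigin φ)
    (h : (Hom.kerGι φ).left.base y = origin A) :
    Hom.kerGStalkMap φ ≫ ((Hom.kerG φ).left.presheaf.stalkCongr (.of_eq hy)).inv =
      (A.X.left.presheaf.stalkCongr (.of_eq h)).inv ≫ (Hom.kerGι φ).left.stalkMap y := by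
  subst hy
  rw [TopCat.Presheaf.stalkCongr_inv, TopCat.Presheaf.stalkSpecializes_refl, Category.comp_id]
  rfl

/-- The `k`-point of `A` defined by evaluation at the origin is the unit section. [cite: GortzWedhorn2020, (6.4) Definition 6.2] -/
theorem ptOfStalkHom_evalOrigin (B : AbelianVariety k) : ptOfStalkHom (CommRingCat.ofHom (evalOrigin B)) = unitPt B := by
  have h := ptOfStalkHom_evAt (R := CommRingCat.of k) (1 : specOver k k ⟶ B.X).left (one_left_base _)
  refine h.trans ?_
  rw [one_left]
  change Spec.map (CommRingCat.ofHom (algebraMap k k)) ≫ unitPt B = unitPt B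
  rw [Algebra.algebraMap_self, CommRingCat.ofHom_id, Spec.map_id, Category.id_comp]

/-- **If `φ^* = 0` on `𝔪_e/𝔪_e²` then `ker ι^* ⊆ 𝔪_e²`.**  Let `R₂ = 𝒪_{A,e}/𝔪_e²` and `t₂ : Spec R₂ → A` the canonical point.  Since
`φ^*(𝔪_{B,e}) ⊆ 𝔪_{A,e}²` and `φ^*` fixes constants, `φ^*` followed by `𝒪_{A,e} → R₂` is «evaluate at `e`, then include the constant»,
so `t₂ ≫ φ` is the unit point and `t₂` factors through `Ker φ` (universal property ★ `kerLift`); the local homomorphism of the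
factorisation is a retraction `r : 𝒪_{Ker φ,e} → R₂` with `r ∘ ι^* = (𝒪_{A,e} → R₂)`, whence `ker ι^* ⊆ 𝔪_e²`
(Görtz–Wedhorn I, (6.4): points with values in local Artin rings and the cotangent space; Definition 4.45 (2): the kernel).
[cite: GortzWedhorn2020, Definition 4.45 (2), p. 117] [cite: GortzWedhorn2020, (6.4) Definition 6.2] -/
private theorem Hom.ker_kerGStalkMap_le (hφ : Hom.cotangentMap φ = 0) :
    RingHom.ker (Hom.kerGStalkMap φ).hom ≤ maximalIdeal (stalkOrigin A) ^ 2 := by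
  set 𝔪 := maximalIdeal (stalkOrigin A) with h𝔪
  -- the local Artin ring `R₂ = 𝒪_{A,e}/𝔪²`
  have hne : 𝔪 ^ 2 ≠ ⊤ := fun htop =>
    (maximalIdeal.isMaximal (stalkOrigin A)).ne_top (top_le_iff.mp (htop ▸ Ideal.pow_le_self two_ne_zero))
  haveI : Nontrivial (stalkOrigin A ⧸ 𝔪 ^ 2) := Ideal.Quotient.nontrivial_iff.mpr hne
  haveI : IsLocalRing (stalkOrigin A ⧸ 𝔪 ^ 2) :=
    IsLocalRing.of_surjective' (Ideal.Quotient.mk (𝔪 ^ 2)) Ideal.Quotient.mk_surjective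
  letI : Algebra k (stalkOrigin A ⧸ 𝔪 ^ 2) := ((Ideal.Quotient.mk (𝔪 ^ 2)).comp (stalkOriginAlgebraMap A)).toAlgebra
  let v : stalkOrigin A ⟶ CommRingCat.of (stalkOrigin A ⧸ 𝔪 ^ 2) := CommRingCat.ofHom (Ideal.Quotient.mk (𝔪 ^ 2))
  haveI hvloc : IsLocalHom v.hom := by
    refine ⟨fun a ha => ?_⟩
    by_contra hna
    have hmem : a ∈ 𝔪 := (mem_maximalIdeal _).mpr hna
    have hsq : (Ideal.Quotient.mk (𝔪 ^ 2) a) ^ 2 = 0 := by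
      rw [← map_pow, Ideal.Quotient.eq_zero_iff_mem]
      exact Ideal.pow_mem_pow hmem 2
    exact (IsNilpotent.not_isUnit ⟨2, hsq⟩) ha
  have hv : v.hom.comp (stalkOriginAlgebraMap A) = algebraMap k (stalkOrigin A ⧸ 𝔪 ^ 2) := rfl
  -- `φ^* ≫ (𝒪_{A,e} → R₂)` is «evaluate at the origin of `B`, then the constant»
  have hφv : Hom.stalkMapOrigin φ ≫ v =
      CommRingCat.ofHom ((algebraMap k (stalkOrigin A ⧸ 𝔪 ^ 2)).comp (evalOrigin B)) := by
    apply CommRingCat.hom_ext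
    apply RingHom.ext
    intro b
    change v (Hom.stalkMapOrigin φ b) = algebraMap k _ (evalOrigin B b)
    have hb := sub_algebraMap_evalOrigin_mem B b
    have hm2 : Hom.stalkMapOrigin φ (b - stalkOriginAlgebraMap B (evalOrigin B b)) ∈ 𝔪 ^ 2 := by
      have h1 := congrArg (fun L => L (Cotangent.mk B ⟨_, hb⟩)) hφ
      simp only [LinearMap.zero_apply, Hom.cotangentMap_mk] at h1
      exact Cotangent.mk_eq_zero_iff.mp h1
    have e1 : Hom.stalkMapOrigin φ b =
        Hom.stalkMapOrigin φ (b - stalkOriginAlgebraMap B (evalOrigin B b)) + stalkOriginAlgebraMap A (evalOrigin B b) := by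
      rw [map_sub, Hom.stalkMapOrigin_algebraMap, sub_add_cancel]
    rw [e1, map_add]
    change Ideal.Quotient.mk (𝔪 ^ 2) _ + Ideal.Quotient.mk (𝔪 ^ 2) _ = _
    rw [Ideal.Quotient.eq_zero_iff_mem.mpr hm2, zero_add]
    rfl
  -- the `R₂`-valued point `t₂` of `A` and `t₂ ≫ φ = 1`
  let t₂ : specOver k (stalkOrigin A ⧸ 𝔪 ^ 2) ⟶ A.X := ptOver v hv
  have ht₂ : t₂ ≫ φ.hom.hom.hom = 1 := by
    apply Over.OverMorphism.ext
    rw [one_left, Over.comp_left]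
    change ptOfStalkHom v ≫ Hom.toSchemeHom φ = (specOver k _).hom ≫ unitPt B
    rw [Hom.ptOfStalkHom_comp_toSchemeHom', hφv, CommRingCat.ofHom_comp, ← SpecMap_comp_ptOfStalkHom]
    exact congrArg (fun g => Spec.map (CommRingCat.ofHom (algebraMap k (stalkOrigin A ⧸ 𝔪 ^ 2))) ≫ g)
      (ptOfStalkHom_evalOrigin B)
  -- `t₂` factors through `Ker φ`; the factorisation is centred at the unit point
  let s₂ : specOver k (stalkOrigin A ⧸ 𝔪 ^ 2) ⟶ Hom.kerG φ := kerLift t₂ ht₂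
  have hs₂ : s₂ ≫ Hom.kerGι φ = t₂ := kerLift_ι _ _
  have hs₂l : s₂.left ≫ (Hom.kerGι φ).left = ptOfStalkHom v := by rw [← Over.comp_left, hs₂]; rfl
  have hy' : (Hom.kerGι φ).left.base (s₂.left.base (closedPoint _)) = origin A := by
    rw [← Scheme.Hom.comp_apply, hs₂l]
    exact ptOfStalkHom_closedPoint v
  haveI := Hom.isClosedImmersion_kerGι_left φ
  have hy : s₂.left.base (closedPoint _) = Hom.kerGOrigin φ :=
    (Hom.kerGι φ).left.isClosedEmbedding.injective (hy'.trans (Hom.kerGι_kerGOrigin φ).symm)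
  -- the retraction identity `r ∘ ι^* = (𝒪_{A,e} → R₂)`
  have key : Hom.kerGStalkMap φ ≫ (((Hom.kerG φ).left.presheaf.stalkCongr (.of_eq hy)).inv ≫
      Scheme.stalkClosedPointTo s₂.left) = v := by
    rw [← Category.assoc, Hom.kerGStalkMap_comp_stalkCongr_inv φ hy hy', Category.assoc]
    refine (congrArg (fun g => (A.X.left.presheaf.stalkCongr (.of_eq hy')).inv ≫ g)
      (Scheme.stalkClosedPointTo_comp s₂.left (Hom.kerGι φ).left).symm).trans ?_
    change evAt (R := CommRingCat.of (stalkOrigin A ⧸ 𝔪 ^ 2)) (s₂.left ≫ (Hom.kerGι φ).left) hy' = v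
    exact (evAt_congr hs₂l hy' (ptOfStalkHom_closedPoint v)).trans (evAt_ptOfStalkHom v _)
  intro a ha
  have h0 : v a = 0 := by
    rw [← key, CommRingCat.comp_apply, RingHom.mem_ker.mp ha, map_zero]
  exact Ideal.Quotient.eq_zero_iff_mem.mp h0

/-! ## §3 Endomorphisms: the stalk map of an endomorphism of `Ker φ` at the unit point, and naturality of `ι^*` -/

section Naturality

variable (v : Hom.kerG φ ⟶ Hom.kerG φ) [IsMonHom v]

/-- A homomorphism `v : Ker φ → Ker φ` fixes the unit point. [cite: GortzWedhorn2020, Definition 4.45 (1), p. 117] -/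
private theorem Hom.kerGEnd_base_kerGOrigin : v.left.base (Hom.kerGOrigin φ) = Hom.kerGOrigin φ := by
  change ((η[Hom.kerG φ] : 𝟙_ (SchemeOver k) ⟶ _).left ≫ v.left).base (specPt k) = _
  rw [← Over.comp_left, IsMonHom.one_hom]

/-- The stalk endomorphism `v^* : 𝒪_{Ker φ,e} → 𝒪_{Ker φ,e}` of a homomorphism `v : Ker φ → Ker φ`, transported along `v(e) = e`.
[cite: GortzWedhorn2020, Remark 6.3 (3)] -/
private def Hom.kerGEndStalkMap : (Hom.kerG φ).left.presheaf.stalk (Hom.kerGOrigin φ) ⟶ (Hom.kerG φ).left.presheaf.stalk (Hom.kerGOrigin φ) :=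
  ((Hom.kerG φ).left.presheaf.stalkCongr (.of_eq (Hom.kerGEnd_base_kerGOrigin φ v))).inv ≫
    v.left.stalkMap (Hom.kerGOrigin φ)

/-- `v^*` on germs: `v^*(s_e) = (v^♯ s)_e`. [cite: GortzWedhorn2020, Remark 6.3 (3)] -/
@[reassoc]
private theorem Hom.germ_kerGEndStalkMap (U : (Hom.kerG φ).left.Opens) (hU : Hom.kerGOrigin φ ∈ U) :
    (Hom.kerG φ).left.presheaf.germ U (Hom.kerGOrigin φ) hU ≫ Hom.kerGEndStalkMap φ v =
      v.left.app U ≫ (Hom.kerG φ).left.presheaf.germ (v.left ⁻¹ᵁ U) (Hom.kerGOrigin φ)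
        (show v.left.base _ ∈ U by rw [Hom.kerGEnd_base_kerGOrigin]; exact hU) := by
  rw [Hom.kerGEndStalkMap, TopCat.Presheaf.stalkCongr_inv, TopCat.Presheaf.germ_stalkSpecializes_assoc,
    Scheme.Hom.germ_stalkMap]

/-- `v^*` on germs of global sections: `v^*(a_e) = (Γ(v) a)_e`. [cite: GortzWedhorn2020, Remark 6.3 (3)] -/
private theorem Hom.kerGEndStalkMap_germ_top (a : Alg (Hom.kerG φ)) :
    Hom.kerGEndStalkMap φ v ((Hom.kerG φ).left.presheaf.germ ⊤ (Hom.kerGOrigin φ) _root_.trivial a) =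
      (Hom.kerG φ).left.presheaf.germ ⊤ (Hom.kerGOrigin φ) _root_.trivial (Alg.comap v a) := by
  rw [← CommRingCat.comp_apply, Hom.germ_kerGEndStalkMap]
  rfl

/-- `v^*` is a local homomorphism. [cite: GortzWedhorn2020, Remark 6.3 (3)] -/
private theorem Hom.isLocalHom_kerGEndStalkMap : IsLocalHom (Hom.kerGEndStalkMap φ v).hom := by
  unfold Hom.kerGEndStalkMap
  rw [CommRingCat.hom_comp]
  infer_instance

/-- **Naturality of `ι^*`**: if `v ≫ ι = ι ≫ u` for an endomorphism `u` of `A`, then `ι^* ∘ u^* = v^* ∘ ι^*` on `𝒪_{A,e}`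
(functoriality of `f ↦ f_x^♯`, Görtz–Wedhorn I, Remark 6.3 (3), checked on germs). [cite: GortzWedhorn2020, Remark 6.3 (3)] -/
private theorem Hom.kerGStalkMap_stalkMapEnd (u : A ⟶ A) (hv : v ≫ Hom.kerGι φ = Hom.kerGι φ ≫ u.hom.hom.hom) (b : stalkOrigin A) :
    Hom.kerGStalkMap φ (stalkMapEnd A u b) = Hom.kerGEndStalkMap φ v (Hom.kerGStalkMap φ b) := by
  have H : v.left ≫ (Hom.kerGι φ).left = (Hom.kerGι φ).left ≫ Hom.toSchemeHom u := by
    rw [← Over.comp_left, hv, Over.comp_left]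
  obtain ⟨U, hU, s, rfl⟩ := A.X.left.presheaf.exists_germ_eq b
  have e1 : stalkMapEnd A u (A.X.left.presheaf.germ U (origin A) hU s) =
      A.X.left.presheaf.germ ((Hom.toSchemeHom u) ⁻¹ᵁ U) (origin A)
        (show (Hom.toSchemeHom u).base (origin A) ∈ U by rwa [toSchemeHom_origin]) ((Hom.toSchemeHom u).app U s) := by
    rw [← CommRingCat.comp_apply, germ_stalkMapEnd, CommRingCat.comp_apply]
  rw [e1, Hom.kerGStalkMap_germ, Hom.kerGStalkMap_germ, ← CommRingCat.comp_apply _ (Hom.kerGEndStalkMap φ v),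
    Hom.germ_kerGEndStalkMap, CommRingCat.comp_apply]
  -- both sides are germs at `e` of the section `s` pulled back along `ι ≫ u = v ≫ ι`
  have e2 : (Hom.kerG φ).left.presheaf.germ _ (Hom.kerGOrigin φ)
        (Hom.kerGOrigin_mem_preimage φ (show (Hom.toSchemeHom u).base (origin A) ∈ U by rwa [toSchemeHom_origin]))
        ((Hom.kerGι φ).left.app _ ((Hom.toSchemeHom u).app U s)) =
      (Hom.kerG φ).left.presheaf.germ (((Hom.kerGι φ).left ≫ Hom.toSchemeHom u) ⁻¹ᵁ U) (Hom.kerGOrigin φ)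
        (show ((Hom.kerGι φ).left ≫ Hom.toSchemeHom u).base (Hom.kerGOrigin φ) ∈ U by
          rw [Scheme.Hom.comp_apply, Hom.kerGι_kerGOrigin, toSchemeHom_origin]; exact hU)
        (((Hom.kerGι φ).left ≫ Hom.toSchemeHom u).app U s) := by
    rw [Scheme.Hom.comp_app]
    rfl
  have e3 : (Hom.kerG φ).left.presheaf.germ _ (Hom.kerGOrigin φ)
        (show v.left.base (Hom.kerGOrigin φ) ∈ (Hom.kerGι φ).left ⁻¹ᵁ U by
          rw [Hom.kerGEnd_base_kerGOrigin]; exact Hom.kerGOrigin_mem_preimage φ hU)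
        (v.left.app _ ((Hom.kerGι φ).left.app U s)) =
      (Hom.kerG φ).left.presheaf.germ ((v.left ≫ (Hom.kerGι φ).left) ⁻¹ᵁ U) (Hom.kerGOrigin φ)
        (show (v.left ≫ (Hom.kerGι φ).left).base (Hom.kerGOrigin φ) ∈ U by
          rw [Scheme.Hom.comp_apply, Hom.kerGEnd_base_kerGOrigin, Hom.kerGι_kerGOrigin]; exact hU)
        ((v.left ≫ (Hom.kerGι φ).left).app U s) := by
    rw [Scheme.Hom.comp_app]
    rfl
  rw [e2, e3]
  have e4 := congrArg (fun f => f s) (congrArg CommRingCat.Hom.hom (Scheme.Hom.congr_app H U))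
  simp only [CommRingCat.hom_comp, RingHom.coe_comp, Function.comp_apply] at e4
  rw [e4, TopCat.Presheaf.germ_res_apply]

end Naturality

/-! ## §4 `φ^* = 0` ⇒ `cot(Ker φ) ≅ cot(A)`: the `k`-linear isomorphism of the global unit cotangent space of the affine `Ker φ` with
`𝔪_{A,e}/𝔪_{A,e}²`, natural in compatible endomorphisms -/

/-- `ι^*` maps `𝔪_{A,e}` into `𝔪_{Ker φ,e}` (a local homomorphism). [cite: GortzWedhorn2020, Remark 6.3 (3)] -/
private theorem Hom.maximalIdeal_le_comap_kerGStalkMap :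
    maximalIdeal (stalkOrigin A) ≤ (maximalIdeal ((Hom.kerG φ).left.presheaf.stalk (Hom.kerGOrigin φ))).comap (Hom.kerGStalkMap φ).hom :=
  haveI := Hom.isLocalHom_kerGStalkMap φ
  (IsLocalRing.maximalIdeal_comap (Hom.kerGStalkMap φ).hom).ge

/-- The engine on the nose of `φ` (abbreviated statement; the public form is `Hom.exists_cotangentEquiv_ker`). [cite: GortzWedhorn2020, (6.4) Definition 6.2] -/
private theorem Hom.exists_cotangentEquiv_kerG (hφ : Hom.cotangentMap φ = 0) [IsAffine (Hom.kerG φ).left] :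
    ∃ Φ : (Hom.kerGUnitIdeal φ).Cotangent ≃ₗ[k] Cotangent A,
      ∀ (u : A ⟶ A) (v : Hom.kerG φ ⟶ Hom.kerG φ) [IsMonHom v], v ≫ Hom.kerGι φ = Hom.kerGι φ ≫ u.hom.hom.hom →
        Φ.toLinearMap ∘ₗ Ideal.mapCotangent _ _ (Alg.comap v) (ker_unit_le_comap v) =
          AbelianVariety.cotangentMap A u ∘ₗ Φ.toLinearMap := by
  -- the rings `𝒪_{A,e}`, `Γ(Ker φ)`, `𝒪_{Ker φ,e}` and their algebra structures
  letI algA : Algebra k (stalkOrigin A) := (stalkOriginAlgebraMap A).toAlgebra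
  letI algT : Algebra (Alg (Hom.kerG φ)) (Hom.kerGStalk φ) := (((Hom.kerG φ).left.presheaf.germ ⊤ (Hom.kerGOrigin φ) _root_.trivial).hom : Alg (Hom.kerG φ) →+* (Hom.kerGStalk φ)).toAlgebra
  letI algkT : Algebra k (Hom.kerGStalk φ) := ((algebraMap (Alg (Hom.kerG φ)) (Hom.kerGStalk φ)).comp (algebraMap k (Alg (Hom.kerG φ)))).toAlgebra
  haveI : IsScalarTower k (Alg (Hom.kerG φ)) (Hom.kerGStalk φ) := IsScalarTower.of_algebraMap_eq (fun _ => rfl)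
  haveI hmax : (Hom.kerGUnitIdeal φ).IsMaximal := unitAugIdeal_isMaximal (Hom.kerG φ)
  haveI := Hom.isLocalHom_kerGStalkMap φ
  haveI hloc : IsLocalization.AtPrime (Hom.kerGStalk φ) (Hom.kerGUnitIdeal φ) :=
    isLocalization_stalk_unitAugIdeal (Hom.kerG φ)
  -- `ι^*` as a `k`-algebra map, and the bijection `β : 𝔪_A/𝔪_A² ⥲ 𝔪_T/𝔪_T²`
  let ψ : stalkOrigin A →ₐ[k] (Hom.kerGStalk φ) :=
    { (Hom.kerGStalkMap φ).hom with commutes' := fun c => Hom.kerGStalkMap_algebraMap φ c }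
  have hle : maximalIdeal (stalkOrigin A) ≤ (maximalIdeal (Hom.kerGStalk φ)).comap ψ := Hom.maximalIdeal_le_comap_kerGStalkMap φ
  have hβ : Function.Bijective (Ideal.mapCotangent (maximalIdeal (stalkOrigin A)) (maximalIdeal (Hom.kerGStalk φ)) ψ hle) :=
    Ideal.mapCotangent_bijective_of_surjective_of_ker_le_sq ψ (Hom.kerGStalkMap_surjective φ) _ _
      (IsLocalRing.maximalIdeal_comap (Hom.kerGStalkMap φ).hom) (Hom.ker_kerGStalkMap_le φ hφ)
  let β := LinearEquiv.ofBijective _ hβ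
  let loc := (Literature.RingTheory.Localization.cotangentLocalizationEquiv (Hom.kerGUnitIdeal φ) (Hom.kerGStalk φ)).restrictScalars k
  refine ⟨loc.trans β.symm, fun u v _ hv => ?_⟩
  haveI := Hom.isLocalHom_kerGEndStalkMap φ v
  -- `v^*` as a `k`-algebra endomorphism of the stalk of `Ker φ`
  have hvalg : ∀ c : k, Hom.kerGEndStalkMap φ v (algebraMap k (Hom.kerGStalk φ) c) = algebraMap k (Hom.kerGStalk φ) c := fun c => by
    change Hom.kerGEndStalkMap φ v ((Hom.kerG φ).left.presheaf.germ ⊤ (Hom.kerGOrigin φ) _root_.trivial (algebraMap k (Alg (Hom.kerG φ)) c)) =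
      (Hom.kerG φ).left.presheaf.germ ⊤ (Hom.kerGOrigin φ) _root_.trivial (algebraMap k (Alg (Hom.kerG φ)) c)
    rw [Hom.kerGEndStalkMap_germ_top, AlgHom.commutes]
  let vs : (Hom.kerGStalk φ) →ₐ[k] (Hom.kerGStalk φ) := { (Hom.kerGEndStalkMap φ v).hom with commutes' := hvalg }
  have hvle : maximalIdeal (Hom.kerGStalk φ) ≤ (maximalIdeal (Hom.kerGStalk φ)).comap vs := (IsLocalRing.maximalIdeal_comap (Hom.kerGEndStalkMap φ v).hom).ge
  -- check after applying the injective `β`, on generators of `I_e/I_e²`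
  apply LinearMap.ext
  intro x
  obtain ⟨⟨a, ha⟩, rfl⟩ := (Hom.kerGUnitIdeal φ).toCotangent_surjective x
  apply β.injective
  simp only [LinearMap.comp_apply, LinearEquiv.coe_coe, LinearEquiv.trans_apply]
  -- left side: `loc (Γ(v)^* ā)` = class of the germ of `Γ(v) a`
  rw [Ideal.mapCotangent_toCotangent]
  have hloc' : ∀ b : Hom.kerGUnitIdeal φ, loc ((Hom.kerGUnitIdeal φ).toCotangent b) =
      (maximalIdeal (Hom.kerGStalk φ)).toCotangent ⟨(Hom.kerG φ).left.presheaf.germ ⊤ (Hom.kerGOrigin φ) _root_.trivial b.1,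
        Literature.RingTheory.Localization.le_comap_maximalIdeal (Hom.kerGUnitIdeal φ) (Hom.kerGStalk φ) b.2⟩ := fun b =>
    Literature.RingTheory.Localization.cotangentLocalizationEquiv_toCotangent (Hom.kerGUnitIdeal φ) (Hom.kerGStalk φ) b
  have hβ_apply : ∀ (b : stalkOrigin A) (hb : b ∈ maximalIdeal (stalkOrigin A)),
      β ((maximalIdeal (stalkOrigin A)).toCotangent ⟨b, hb⟩) = (maximalIdeal (Hom.kerGStalk φ)).toCotangent ⟨ψ b, hle hb⟩ := fun b hb => by
    rw [LinearEquiv.ofBijective_apply, Ideal.mapCotangent_toCotangent]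
  -- unfold the left side: `loc (Γ(v)^* ā)` is the class of the germ of `Γ(v) a`
  have L : β (β.symm (loc ((Hom.kerGUnitIdeal φ).toCotangent ⟨Alg.comap v a, ker_unit_le_comap v ha⟩))) =
      (maximalIdeal (Hom.kerGStalk φ)).toCotangent
        ⟨(Hom.kerG φ).left.presheaf.germ ⊤ (Hom.kerGOrigin φ) _root_.trivial (Alg.comap v a),
          Literature.RingTheory.Localization.le_comap_maximalIdeal (Hom.kerGUnitIdeal φ) _ (ker_unit_le_comap v ha)⟩ :=
    (LinearEquiv.apply_symm_apply β _).trans (hloc' ⟨_, _⟩)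
  -- the right side: write `β⁻¹ (loc ā)` as the class of some `b ∈ 𝔪_{A,e}`; then `ι^* b` and the germ of `a` agree mod `𝔪²`
  obtain ⟨⟨b, hb⟩, hy⟩ :=
    (maximalIdeal (stalkOrigin A)).toCotangent_surjective (β.symm (loc ((Hom.kerGUnitIdeal φ).toCotangent ⟨a, ha⟩)))
  have E1 : (maximalIdeal (Hom.kerGStalk φ)).toCotangent ⟨ψ b, hle hb⟩ =
      (maximalIdeal (Hom.kerGStalk φ)).toCotangent
        ⟨(Hom.kerG φ).left.presheaf.germ ⊤ (Hom.kerGOrigin φ) _root_.trivial a,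
          Literature.RingTheory.Localization.le_comap_maximalIdeal (Hom.kerGUnitIdeal φ) _ ha⟩ :=
    (hβ_apply b hb).symm.trans ((congrArg β hy).trans ((LinearEquiv.apply_symm_apply β _).trans (hloc' ⟨a, ha⟩)))
  have R : β (AbelianVariety.cotangentMap A u (β.symm (loc ((Hom.kerGUnitIdeal φ).toCotangent ⟨a, ha⟩)))) =
      (maximalIdeal (Hom.kerGStalk φ)).toCotangent
        ⟨(Hom.kerG φ).left.presheaf.germ ⊤ (Hom.kerGOrigin φ) _root_.trivial (Alg.comap v a),
          Literature.RingTheory.Localization.le_comap_maximalIdeal (Hom.kerGUnitIdeal φ) _ (ker_unit_le_comap v ha)⟩ :=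
    calc β (AbelianVariety.cotangentMap A u (β.symm (loc ((Hom.kerGUnitIdeal φ).toCotangent ⟨a, ha⟩))))
        = β (AbelianVariety.cotangentMap A u (Cotangent.mk A ⟨b, hb⟩)) :=
          congrArg (fun y => β (AbelianVariety.cotangentMap A u y)) hy.symm
      _ = β (Cotangent.mk A ⟨stalkMapEnd A u b, stalkMapEnd_mem u hb⟩) :=
          congrArg β (AbelianVariety.cotangentMap_mk u ⟨b, hb⟩)
      _ = (maximalIdeal _).toCotangent ⟨ψ (stalkMapEnd A u b), hle (stalkMapEnd_mem u hb)⟩ := hβ_apply _ _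
      _ = (maximalIdeal _).toCotangent ⟨vs (ψ b), hvle (hle hb)⟩ :=
          congrArg _ (Subtype.ext (Hom.kerGStalkMap_stalkMapEnd φ v u hv b))
      _ = Ideal.mapCotangent _ _ vs hvle ((maximalIdeal _).toCotangent ⟨ψ b, hle hb⟩) :=
          (Ideal.mapCotangent_toCotangent (maximalIdeal _) (maximalIdeal _) vs hvle ⟨ψ b, hle hb⟩).symm
      _ = Ideal.mapCotangent _ _ vs hvle ((maximalIdeal _).toCotangent
            ⟨(Hom.kerG φ).left.presheaf.germ ⊤ (Hom.kerGOrigin φ) _root_.trivial a,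
              Literature.RingTheory.Localization.le_comap_maximalIdeal (Hom.kerGUnitIdeal φ) _ ha⟩) :=
          congrArg _ E1
      _ = (maximalIdeal _).toCotangent ⟨vs ((Hom.kerG φ).left.presheaf.germ ⊤ (Hom.kerGOrigin φ) _root_.trivial a), hvle
            (Literature.RingTheory.Localization.le_comap_maximalIdeal (Hom.kerGUnitIdeal φ) _ ha)⟩ :=
          Ideal.mapCotangent_toCotangent _ _ _ _ _
      _ = _ := congrArg _ (Subtype.ext (Hom.kerGEndStalkMap_germ_top φ v a))
  exact L.trans R.symm

/-! ## §5 The general kernel (any `f` underlying `φ`) and the TORSION `A[N]`, `N = 0` in `k` -/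

/-- **THE ENGINE — `φ^* = 0` on `𝔪_e/𝔪_e²` ⇒ `I_e(Ker φ)/I_e(Ker φ)² ≅ 𝔪_{A,e}/𝔪_{A,e}²`, naturally.**  For a homomorphism `φ : A → B` of
abelian varieties over `k` whose cotangent map `φ^* : 𝔪_{B,e}/𝔪² → 𝔪_{A,e}/𝔪²` VANISHES and whose group-scheme kernel `Ker φ` is AFFINE
(e.g. `φ` an isogeny, `φ = [N]`), there is a `k`-linear isomorphism `Φ` from the cotangent module `I_e/I_e²` of the augmentation
ideal `I_e ⊆ Γ(Ker φ, 𝒪)` (★ N1c ∕ P6b `htan` currency) onto `AbelianVariety.Cotangent A = 𝔪_{A,e}/𝔪_{A,e}²` (the kernel formed on a syntactically arbitrary `f = φ`, so that `f := [N]` gives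
the torsion `A[N]` of ★ `AbelianSchemeOver.torsion` on the nose), NATURAL in pairs
`(u, v)` of an endomorphism `u` of `A` and a homomorphism `v : Ker φ → Ker φ` with `v ≫ ι = ι ≫ u`: `Φ ∘ Γ(v)^* = u^* ∘ Φ`.
Assembly: `I_e/I_e² ≅ 𝔪_{Ker,e}/𝔪²` (★ `cotangentLocalizationEquiv`, the stalk is the localisation at the maximal `I_e`) and
`ι^* : 𝔪_{A,e}/𝔪² ⥲ 𝔪_{Ker,e}/𝔪²` (surjective closed immersion, kernel in `𝔪²` by §2) (Görtz–Wedhorn I, (6.4): `T_e(Ker f) = Ker(T_e f)`,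
dually). [cite: GortzWedhorn2020, (6.4) Definition 6.2] [cite: GortzWedhorn2020, Definition 4.45 (2), p. 117] -/
theorem Hom.exists_cotangentEquiv_ker (f : A.X ⟶ B.X) (hfm : IsMonHom f) (hf : φ.hom.hom.hom = f) (hφ : Hom.cotangentMap φ = 0)
    [haff : IsAffine (GroupSchemeKernel.ker f).left] :
    haveI := hfm
    ∃ Φ : (RingHom.ker ((η[GroupSchemeKernel.ker f] : 𝟙_ (SchemeOver k) ⟶ _).left.appTop.hom) :
        Ideal (Alg (GroupSchemeKernel.ker f))).Cotangent ≃ₗ[k] Cotangent A,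
      ∀ (u : A ⟶ A) (v : GroupSchemeKernel.ker f ⟶ GroupSchemeKernel.ker f) [IsMonHom v],
        v ≫ GroupSchemeKernel.kerι f = GroupSchemeKernel.kerι f ≫ u.hom.hom.hom →
        Φ.toLinearMap ∘ₗ Ideal.mapCotangent _ _ (Alg.comap v) (ker_unit_le_comap v) =
          AbelianVariety.cotangentMap A u ∘ₗ Φ.toLinearMap := by
  subst hf
  exact Hom.exists_cotangentEquiv_kerG φ hφ

end AbelianVariety

end Literature.AlgebraicGeometry.Motives

end
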